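import Summits.CriticalPhenomena.SAWScalingLimit.Theses.SAWRestrictionRigidity
import Summits.CriticalPhenomena.SAWScalingLimit.Theses.SAWRestrictionDescent
import Summits.CriticalPhenomena.SAWScalingLimit.Theses.SAWZoomRigidity
import Literature.Probability.RandomPlanarGeometry.RadoContinuity

/-!
# Crux `Rigidity` (stmt-CriticalPhenomena-1368) — the REPAIRED statement C′, typed and checked (lead c4, 2026-08-17)

Two consecutive leads (c3, c4) return `verdict: misstated` on the crux AS TYPED: `ChordalFamily` is an
arbitrary function of the marked Jordan domain, and every candidate counterexample (domain-keyed
conformal structures propagated along the restriction-coupled Markov chain, crux idea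
`Ideas/texture-keyed-modulus.md`) as well as every conceivable proof of the typed statement hinges on
fine almost-sure geometry of SLE(8/3) tips at closed-set hitting times — mathematics unrelated to the
self-avoiding walk (see `AUDIT-c4.md`). The repair both leads recommend is to insert, before the
conclusion, the **Radó-continuity clause** that route SAWRestrictionDescent already types verbatim
(hypothesis 5 of `TopRes`; conclusion of `ContinuityOfLimit`, stmt-CriticalPhenomena-7305):
`Φₙ → Φ` uniformly on `closure D`, `Φ` conformal and injective on `closure D`, `Φₙ` likewise,
`Dₙ = Φₙ(D)`, `D' = Φ(D)` with image marks ⇒ `P Dₙ ⇀ P D'`.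

This file makes the restatement executable for the planner of BOTH routes that want the crux
(SAWRestrictionRigidity r2, SAWZoomRigidity r3 — the decl is shared verbatim):

* `RigidityC` — the repaired crux, written INLINE in the style of the route file (fully qualified,
  elaborates standalone with the route file's imports + `…Theses.SAWRestrictionDescent` not needed:
  the clause only uses Mathlib + `ChordalCurveFamily`); copy its body as the new signature.
* `rigidityC_of_rigidity : Rigidity → RigidityC` — C′ asks for LESS than the typed crux (sanity).
* `closesC : RigidityC → AxiomsOfLimit → ContinuityOfLimit → LimitExists → LSWRestrictionFact83 →
  SAWScalingLimit` — the route's deciding theorem re-proved with the repaired crux and ONE extra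
  item, `ContinuityOfLimit` = stmt-CriticalPhenomena-7305 of route SAWRestrictionDescent VERBATIM
  (so the restated route shares that existing item instead of filing a new one). Sorry-free.

Why C′ is the right repair (details in `AUDIT-c4.md`): (i) it is implied by the intended conclusion
(conformal covariance gives `P Dₙ = (Φₙ)_* P D ⇀ Φ_* P D = P D'` by uniform convergence on the
compact traces), so C′ is still a consequence of "the SAW limit is SLE(8/3)"; (ii) it kills every
domain-keyed family (inner conformal approximants `Φ(rₙ𝔻)` of any marked domain are analytic, and a
key that is constant along them and similarity-equivariant is pinned by the quarter-turn); (iii) with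
it the crux is exactly the open problem of LSW04 §3.4.5 (= `TopTriv ∧ TopRes` of the descent route).
-/

namespace Summit.CriticalPhenomena.SAWScalingLimit.Cruxes.Rigidity.Repair

open MeasureTheory Filter
open Summit.CriticalPhenomena.SAWScalingLimit.Theses

/-- **C′ — the repaired crux `Rigidity`** (lead c3/c4 verdict `misstated`): the typed hypotheses of
`…Theses.SAWRestrictionRigidity.Rigidity` VERBATIM, plus (last hypothesis) the Radó-continuity
clause of `…Theses.SAWRestrictionDescent.TopRes` / conclusion of `ContinuityOfLimit`
(stmt-CriticalPhenomena-7305) VERBATIM, imply conformal covariance. Written fully qualified so that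
the body can be pasted as the restated item signature. -/
def RigidityC : Prop :=
  ∀ P : Literature.Probability.RandomPlanarGeometry.ChordalFamily, P.IsChordal → P.IsRestriction → (∃ Q : Literature.Probability.RandomPlanarGeometry.DobrushinDomain → Literature.Probability.RandomPlanarGeometry.CurveClass ℂ → MeasureTheory.Measure (Literature.Probability.RandomPlanarGeometry.CurveClass ℂ), P.IsMarkovExtension Q ∧ ∀ (D : Literature.Probability.RandomPlanarGeometry.DobrushinDomain) (p : Literature.Probability.RandomPlanarGeometry.CurveClass ℂ) (D' : Literature.Probability.RandomPlanarGeometry.DobrushinDomain), D'.carrier ⊆ Literature.Probability.RandomPlanarGeometry.remainingDomain D p → D'.pt 0 = p.target → D'.pt 1 = D.pt 1 → ∀ T : Set (Literature.Probability.RandomPlanarGeometry.CurveClass ℂ), MeasurableSet T → P D' T * Q D p (Literature.Probability.RandomPlanarGeometry.CurveClass.rangeSubset (closure D'.carrier)) = Q D p (T ∩ Literature.Probability.RandomPlanarGeometry.CurveClass.rangeSubset (closure D'.carrier))) → (∀ D D' : Literature.Probability.RandomPlanarGeometry.DobrushinDomain, D'.carrier = D.carrier → D'.pt 0 = D.pt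 1 → D'.pt 1 = D.pt 0 → P D' = (P D).map Literature.Probability.RandomPlanarGeometry.CurveClass.reverse) → (∀ (D : Literature.Probability.RandomPlanarGeometry.DobrushinDomain) (c : ℂ) (hc : c ≠ 0) (w : ℂ), (∃ (r : ℝ) (k : ℕ), 0 < r ∧ c = (r : ℂ) * Complex.I ^ k) → P (D.map (Literature.Probability.RandomPlanarGeometry.similarity c hc w)) = (P D).map (Literature.Probability.RandomPlanarGeometry.CurveClass.map (Literature.Probability.RandomPlanarGeometry.similarity c hc w : C(ℂ, ℂ)))) → (∀ D : Literature.Probability.RandomPlanarGeometry.DobrushinDomain, P (D.map Complex.conjLIE.toHomeomorph) = (P D).map (Literature.Probability.RandomPlanarGeometry.CurveClass.map (Complex.conjLIE.toHomeomorph : C(ℂ, ℂ)))) → (∀ D : Literature.Probability.RandomPlanarGeometry.DobrushinDomain, ∀ᵐ γ ∂(P D), γ ∈ Literature.Probability.RandomPlanarGeometry.CurveClass.simple ∧ γ.range ∩ frontier D.carrier ⊆ {D.pt 0, D.pt 1}) → (∀ (D D' : Literature.Probability.RandomPlanarGeometry.DobrushinDomain) (Dn : ℕ → Literature.Probability.RandomPlanarGeometry.DobrushinDomain)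 (Φ : C(ℂ, ℂ)) (Φn : ℕ → C(ℂ, ℂ)), TendstoUniformlyOn (fun n => ⇑(Φn n)) Φ Filter.atTop (closure D.carrier) → DifferentiableOn ℂ Φ D.carrier → Set.InjOn Φ (closure D.carrier) → (∀ n, DifferentiableOn ℂ (Φn n) D.carrier ∧ Set.InjOn (Φn n) (closure D.carrier)) → D'.carrier = Φ '' D.carrier → D'.pt 0 = Φ (D.pt 0) → D'.pt 1 = Φ (D.pt 1) → (∀ n, (Dn n).carrier = Φn n '' D.carrier ∧ (Dn n).pt 0 = Φn n (D.pt 0) ∧ (Dn n).pt 1 = Φn n (D.pt 1)) → ∀ f : BoundedContinuousFunction (Literature.Probability.RandomPlanarGeometry.CurveClass ℂ) ℝ, Filter.Tendsto (fun n => ∫ γ, f γ ∂(P (Dn n))) Filter.atTop (nhds (∫ γ, f γ ∂(P D')))) → P.IsConformallyCovariant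

/-- Sanity: the repaired crux C′ is implied by the crux as typed (it has one more hypothesis and the
same conclusion), so restating loses nothing that a proof of the typed crux would have given. -/
theorem rigidityC_of_rigidity : SAWRestrictionRigidity.Rigidity → RigidityC := by
  intro hR P hch hres hmk hrev hsim hconj hsimple _hcont
  exact hR P hch hres hmk hrev hsim hconj hsimple

/-- The inserted clause is VERBATIM the tree notion `ChordalFamily.IsRadoContinuous`
(`RadoContinuity.lean`, definition item of route SAWRestrictionDescent): C′ reads
"the seven typed hypotheses and Radó continuity imply conformal covariance". -/
theorem rigidityC_iff : RigidityC ↔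
    ∀ P : Literature.Probability.RandomPlanarGeometry.ChordalFamily, P.IsChordal → P.IsRestriction → (∃ Q : Literature.Probability.RandomPlanarGeometry.DobrushinDomain → Literature.Probability.RandomPlanarGeometry.CurveClass ℂ → MeasureTheory.Measure (Literature.Probability.RandomPlanarGeometry.CurveClass ℂ), P.IsMarkovExtension Q ∧ ∀ (D : Literature.Probability.RandomPlanarGeometry.DobrushinDomain) (p : Literature.Probability.RandomPlanarGeometry.CurveClass ℂ) (D' : Literature.Probability.RandomPlanarGeometry.DobrushinDomain), D'.carrier ⊆ Literature.Probability.RandomPlanarGeometry.remainingDomain D p → D'.pt 0 = p.target → D'.pt 1 = D.pt 1 → ∀ T : Set (Literature.Probability.RandomPlanarGeometry.CurveClass ℂ), MeasurableSet T → P D' T * Q D p (Literature.Probability.RandomPlanarGeometry.CurveClass.rangeSubset (closure D'.carrier)) = Q D p (T ∩ Literature.Probability.RandomPlanarGeometry.CurveClass.rangeSubset (closure D'.carrier))) → (∀ D D' : Literature.Probability.RandomPlanarGeometry.DobrushinDomain, D'.carrier = D.carrier → D'.pt 0 = D.pt 1 → D'.pt 1 = D.pt 0 → P D' = (P D).map Literature.Probability.RandomPlanarGeometry.CurveClass.reverse)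 → (∀ (D : Literature.Probability.RandomPlanarGeometry.DobrushinDomain) (c : ℂ) (hc : c ≠ 0) (w : ℂ), (∃ (r : ℝ) (k : ℕ), 0 < r ∧ c = (r : ℂ) * Complex.I ^ k) → P (D.map (Literature.Probability.RandomPlanarGeometry.similarity c hc w)) = (P D).map (Literature.Probability.RandomPlanarGeometry.CurveClass.map (Literature.Probability.RandomPlanarGeometry.similarity c hc w : C(ℂ, ℂ)))) → (∀ D : Literature.Probability.RandomPlanarGeometry.DobrushinDomain, P (D.map Complex.conjLIE.toHomeomorph) = (P D).map (Literature.Probability.RandomPlanarGeometry.CurveClass.map (Complex.conjLIE.toHomeomorph : C(ℂ, ℂ)))) → (∀ D : Literature.Probability.RandomPlanarGeometry.DobrushinDomain, ∀ᵐ γ ∂(P D), γ ∈ Literature.Probability.RandomPlanarGeometry.CurveClass.simple ∧ γ.range ∩ frontier D.carrier ⊆ {D.pt 0, D.pt 1}) → P.IsRadoContinuous → P.IsConformallyCovariant :=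
  Iff.rfl

/-- **The inserted hypothesis is implied by the conclusion** (tree theorem
`IsConformallyCovariant.isRadoContinuous_of_isChordal`: covariance transports `P D` along `Φₙ`,
and `Φₙ ∘ γ → Φ ∘ γ` uniformly on the compact traces): a chordal, conformally covariant family IS
Radó-continuous. Hence C′ is still a consequence of the intended identification of the SAW limit
with SLE(8/3) — the restatement removes only families that the conclusion itself excludes. -/
theorem isRadoContinuous_of_conclusion (P : Literature.Probability.RandomPlanarGeometry.ChordalFamily)
    (hP : P.IsChordal) (hcov : P.IsConformallyCovariant) : P.IsRadoContinuous :=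
  hcov.isRadoContinuous_of_isChordal hP

/-- Consequently, on chordal families the conclusion of the typed crux is EQUIVALENT to
"Radó-continuous ∧ conformally covariant": the typed crux and C′ differ exactly on the families that
satisfy the seven lattice-exact axioms but are not Radó-continuous (the domain-keyed candidates of
`Ideas/texture-keyed-modulus.md`), none of which can be a SAW scaling limit once
`ContinuityOfLimit` (stmt-7305) holds. -/
theorem conclusion_iff_rado_and_conclusion (P : Literature.Probability.RandomPlanarGeometry.ChordalFamily)
    (hP : P.IsChordal) : P.IsConformallyCovariant ↔ (P.IsRadoContinuous ∧ P.IsConformallyCovariant) :=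
  ⟨fun h => ⟨h.isRadoContinuous_of_isChordal hP, h⟩, fun h => h.2⟩

/-- The extra hypothesis of C′ is, for a full SAW scaling limit, exactly the conclusion of the
EXISTING item `ContinuityOfLimit` (stmt-CriticalPhenomena-7305, route SAWRestrictionDescent). -/
theorem continuity_clause_of_continuityOfLimit (hC : SAWRestrictionDescent.ContinuityOfLimit)
    (P : Literature.Probability.RandomPlanarGeometry.ChordalFamily) (hP : P.IsChordal)
    (hlim : ∀ (D : Literature.Probability.RandomPlanarGeometry.DobrushinDomain)
      (a b : ℝ → Literature.Probability.LatticeModels.Site 2),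
      Literature.Probability.RandomPlanarGeometry.SAW.IsEndpointApprox D a b →
        Literature.Probability.RandomPlanarGeometry.TendstoLaw
          (fun δ (γ : Literature.Probability.RandomPlanarGeometry.SAW.DomainSAW D.carrier δ (a δ) (b δ)) => γ.curve)
          (fun δ => Literature.Probability.RandomPlanarGeometry.SAW.law D.carrier δ (a δ) (b δ)) id (P D)) :
    ∀ (D D' : Literature.Probability.RandomPlanarGeometry.DobrushinDomain)
      (Dn : ℕ → Literature.Probability.RandomPlanarGeometry.DobrushinDomain) (Φ : C(ℂ, ℂ)) (Φn : ℕ → C(ℂ, ℂ)),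
      TendstoUniformlyOn (fun n => ⇑(Φn n)) Φ Filter.atTop (closure D.carrier) →
      DifferentiableOn ℂ Φ D.carrier → Set.InjOn Φ (closure D.carrier) →
      (∀ n, DifferentiableOn ℂ (Φn n) D.carrier ∧ Set.InjOn (Φn n) (closure D.carrier)) →
      D'.carrier = Φ '' D.carrier → D'.pt 0 = Φ (D.pt 0) → D'.pt 1 = Φ (D.pt 1) →
      (∀ n, (Dn n).carrier = Φn n '' D.carrier ∧ (Dn n).pt 0 = Φn n (D.pt 0) ∧ (Dn n).pt 1 = Φn n (D.pt 1)) →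
      ∀ f : BoundedContinuousFunction (Literature.Probability.RandomPlanarGeometry.CurveClass ℂ) ℝ,
        Filter.Tendsto (fun n => ∫ γ, f γ ∂(P (Dn n))) Filter.atTop (nhds (∫ γ, f γ ∂(P D'))) :=
  hC P hP hlim

/-- **The repaired deciding theorem.** With the crux restated as C′ (`RigidityC`) the route
SAWRestrictionRigidity still closes, at the price of ONE extra load-bearing item, the existing
`ContinuityOfLimit` (stmt-CriticalPhenomena-7305) taken VERBATIM from route SAWRestrictionDescent:
`RigidityC → AxiomsOfLimit → ContinuityOfLimit → LimitExists → LSWRestrictionFact83 → SAWScalingLimit`.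
Proof = the route file's `closes` with the continuity clause threaded through. -/
theorem closesC : RigidityC → SAWRestrictionRigidity.AxiomsOfLimit → SAWRestrictionDescent.ContinuityOfLimit →
    SAWRestrictionRigidity.LimitExists → SAWRestrictionRigidity.LSWRestrictionFact83 → _root_.SAWScalingLimit := by
  intro hR hA hC hL h83 D a b hab
  obtain ⟨P, hPch, hlim⟩ := hL
  obtain ⟨hres, hmk, hrev, hsim, hconj, hsimple⟩ := hA P hPch hlim
  have hcont := continuity_clause_of_continuityOfLimit hC P hPch hlim
  have hcc : P.IsConformallyCovariant := hR P hPch hres hmk hrev hsim hconj hsimple hcont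
  obtain ⟨Γ, hΓ, hPD⟩ := h83 P hPch hcc hres hsimple D
  refine ⟨Γ, hΓ, Filter.Eventually.of_forall fun δ =>
    Literature.Probability.RandomPlanarGeometry.SAW.aemeasurable_curve _ _ _ _, fun f => ?_⟩
  have key : ∫ γ, f γ ∂(P D) = ∫ ω, f (Γ ω) ∂Literature.Probability.Process.preWienerMeasure := by
    rw [hPD]
    exact MeasureTheory.integral_map hΓ.aemeasurable f.continuous.aestronglyMeasurable
  rw [← key]
  exact hlim D a b hab f

/-- The same repair serves route SAWZoomRigidity, whose `Rigidity` (r3) is the shared decl verbatim: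
its typed crux also implies C′. -/
theorem rigidityC_of_zoomRigidity : SAWZoomRigidity.Rigidity → RigidityC := by
  intro hR P hch hres hmk hrev hsim hconj hsimple _hcont
  exact hR P hch hres hmk hrev hsim hconj hsimple

end Summit.CriticalPhenomena.SAWScalingLimit.Cruxes.Rigidity.Repair
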